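import Summits.NavierStokesRegularity.NavierStokesRegularity.Theorems.EulerZoomLiouvillePowerGaugeEulerLiouvilleNeedleSphereThinness

/-!
# Tools for the sphere-by-sphere gradient-growth theorem (plate S4a of ROUND-36 «the needle's price, sphere by sphere»)

Fast-point bookkeeping and the real-variable lemmas consumed by `NeedleSphereGrowth.gradient_growth_of_fastSpheres`
(file 2/2, `…NeedleSphereGrowth.lean`):

* `norm_ge_of_fast`, `norm_sub_le_of_grad`, `fast_value_lt` — a `γ`-fast point `⟪y, V y⟫ ≤ −γ‖y‖²` on `S_t`, `t ∈ (L,2L)`,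
  has `γt ≤ ‖V y‖ < G·L` once `‖∇V‖ ≤ G` on `B_{3L}` and `L` is large against the A-growth (Chebyshev on `B(y, L/2)`);
* `core_on_sphere`, `chart_core` — the mean-value step: the flux observable `−⟪y′, V y′⟫` stays `≥ (γ/2)t²` on the
  spherical cap `‖y′ − y‖ ≤ η`, `η = min(L/2, γL/(7G))`, read through the orthographic chart (Lipschitz constant `23/10`
  on the `0.9t` chart disc);
* `aux_budget`, `aux_exponent`, `aux_contra` — the area budget, the exponent comparison
  `β L^{2+ρ} ≤ 19π(γ/2)²t⁴L/(12800(𝓐 + 4L²𝓔))` with `β = 19πγ²/(51200(2(c+1) + 8C))`, and the final contradiction step.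

No Euler content. [folklore]
-/

set_option linter.dupNamespace false

open MeasureTheory Set Metric Real
open scoped RealInnerProductSpace ENNReal NNReal

namespace Summit.NavierStokesRegularity.NavierStokesRegularity.Theorems.PowerGaugeEulerLiouville.NeedleSphereGrowth

open NeedleDiscChart NeedleSphereChart NeedleThinness

section FastPoint

variable {V : EuclideanSpace ℝ (Fin 3) → EuclideanSpace ℝ (Fin 3)}

/-- A `γ`-fast point `⟪y, V y⟫ ≤ −γ‖y‖²` on the sphere of radius `t > 0` has `‖V y‖ ≥ γ t`. [folklore] -/
theorem norm_ge_of_fast {y : EuclideanSpace ℝ (Fin 3)} {γ t : ℝ} (ht : 0 < t) (hy : ‖y‖ = t)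
    (hfast : ⟪y, V y⟫ ≤ -(γ * ‖y‖ ^ 2)) : γ * t ≤ ‖V y‖ := by
  have hcs : -⟪y, V y⟫ ≤ ‖y‖ * ‖V y‖ := (neg_le_abs _).trans (abs_real_inner_le_norm _ _)
  rw [hy] at hcs hfast
  nlinarith

/-- Mean-value step on the closed ball `B̄(y, L/2) ⊆ B_{3L}` (`‖y‖ < 2L`): `‖V y′ − V y‖ ≤ G‖y′ − y‖` if `‖∇V‖ ≤ G` on `B_{3L}`.
[folklore] -/
theorem norm_sub_le_of_grad (hVd : Differentiable ℝ V) {L G : ℝ} {y y' : EuclideanSpace ℝ (Fin 3)}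
    (hG : ∀ x ∈ ball (0 : EuclideanSpace ℝ (Fin 3)) (3 * L), ‖fderiv ℝ V x‖ ≤ G) (hy : ‖y‖ < 2 * L)
    (hy' : ‖y' - y‖ ≤ L / 2) : ‖V y' - V y‖ ≤ G * ‖y' - y‖ := by
  have hL : 0 < L := by linarith [norm_nonneg y]
  have hsub : closedBall y (L / 2) ⊆ ball (0 : EuclideanSpace ℝ (Fin 3)) (3 * L) := by
    intro x hx
    rw [mem_closedBall, dist_eq_norm] at hx
    rw [mem_ball_zero_iff]
    calc ‖x‖ = ‖(x - y) + y‖ := by rw [sub_add_cancel]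
      _ ≤ ‖x - y‖ + ‖y‖ := norm_add_le _ _
      _ < 3 * L := by linarith
  exact (convex_closedBall y (L / 2)).norm_image_sub_le_of_norm_fderiv_le (𝕜 := ℝ)
    (fun x _ => hVd.differentiableAt) (fun x hx => hG x (hsub hx)) (mem_closedBall_self (by linarith))
    (mem_closedBall.2 (by rwa [dist_eq_norm]))

/-- **No tall values at fast points.**  With the A-growth at radius `3L`, `L ≥ 1`, `L ≥ 24(c+1)/γ²` and `‖∇V‖ ≤ G` on
`B_{3L}`, a `γ`-fast point `y` on a sphere of radius `t ∈ (L, 2L)` has `‖V y‖ < G·L` — else `|V| ≥ γL/2` on `B(y, L/2)`,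
whose `L²`-mass `πγ²L⁵/24` exceeds the A-budget `3cL`. [folklore; Chebyshev] -/
theorem fast_value_lt (hVd : Differentiable ℝ V) {c : ℝ≥0} {ρ γ L t G : ℝ} {y : EuclideanSpace ℝ (Fin 3)} (hρ : 0 ≤ ρ)
    (hA3 : ∫⁻ x in ball (0 : EuclideanSpace ℝ (Fin 3)) (3 * L), ‖V x‖ₑ ^ 2 ≤
      (c : ℝ≥0∞) * ENNReal.ofReal ((3 * L) ^ (1 - 2 * ρ)))
    (hγ : 0 < γ) (hL1 : 1 ≤ L) (hLc : 24 * ((c : ℝ) + 1) / γ ^ 2 ≤ L)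
    (hG : ∀ x ∈ ball (0 : EuclideanSpace ℝ (Fin 3)) (3 * L), ‖fderiv ℝ V x‖ ≤ G)
    (ht : t ∈ Ioo L (2 * L)) (hy : ‖y‖ = t) (hfast : ⟪y, V y⟫ ≤ -(γ * ‖y‖ ^ 2)) : ‖V y‖ < G * L := by
  by_contra hcon
  rw [not_lt] at hcon
  have hL : 0 < L := by linarith
  have htpos : 0 < t := hL.trans ht.1
  have hVy : γ * t ≤ ‖V y‖ := norm_ge_of_fast htpos hy hfast
  have hγt : γ * L ≤ γ * t := mul_le_mul_of_nonneg_left ht.1.le hγ.le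
  have hy2 : ‖y‖ < 2 * L := by rw [hy]; exact ht.2
  have hG0 : 0 ≤ G := (norm_nonneg _).trans (hG 0 (mem_ball_self (by linarith)))
  have hlow : ∀ y' ∈ ball y (L / 2), γ * L / 2 ≤ ‖V y'‖ := by
    intro y' hy'
    rw [mem_ball, dist_eq_norm] at hy'
    have hmv := norm_sub_le_of_grad hVd hG hy2 hy'.le
    have h1 : ‖V y‖ - ‖V y' - V y‖ ≤ ‖V y'‖ := by
      have h := norm_sub_norm_le (V y) (V y')
      rw [norm_sub_rev] at h
      linarith
    have h2 : G * ‖y' - y‖ ≤ G * (L / 2) := mul_le_mul_of_nonneg_left hy'.le hG0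
    linarith
  have hsub : ball y (L / 2) ⊆ ball (0 : EuclideanSpace ℝ (Fin 3)) (3 * L) := by
    intro x hx
    rw [mem_ball, dist_eq_norm] at hx
    rw [mem_ball_zero_iff]
    calc ‖x‖ = ‖(x - y) + y‖ := by rw [sub_add_cancel]
      _ ≤ ‖x - y‖ + ‖y‖ := norm_add_le _ _
      _ < 3 * L := by linarith
  have hmass : ENNReal.ofReal ((γ * L / 2) ^ 2 * ((L / 2) ^ 3 * (π * 4 / 3))) ≤
      ∫⁻ x in ball (0 : EuclideanSpace ℝ (Fin 3)) (3 * L), ‖V x‖ₑ ^ 2 := by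
    calc ENNReal.ofReal ((γ * L / 2) ^ 2 * ((L / 2) ^ 3 * (π * 4 / 3)))
        = ENNReal.ofReal ((γ * L / 2) ^ 2) * volume (ball y (L / 2)) := by
          rw [EuclideanSpace.volume_ball_fin_three, ← ENNReal.ofReal_pow (by positivity),
            ← ENNReal.ofReal_mul (by positivity), ← ENNReal.ofReal_mul (by positivity)]
      _ = ∫⁻ _ in ball y (L / 2), ENNReal.ofReal ((γ * L / 2) ^ 2) := (setLIntegral_const _ _).symm
      _ ≤ ∫⁻ x in ball y (L / 2), ‖V x‖ₑ ^ 2 := by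
          refine setLIntegral_mono' measurableSet_ball fun x hx => ?_
          rw [← ofReal_norm, ← ENNReal.ofReal_pow (norm_nonneg _)]
          exact ENNReal.ofReal_le_ofReal (pow_le_pow_left₀ (by positivity) (hlow x hx) 2)
      _ ≤ ∫⁻ x in ball (0 : EuclideanSpace ℝ (Fin 3)) (3 * L), ‖V x‖ₑ ^ 2 := lintegral_mono_set hsub
  have hup : (c : ℝ≥0∞) * ENNReal.ofReal ((3 * L) ^ (1 - 2 * ρ)) ≤ ENNReal.ofReal ((c : ℝ) * (3 * L)) := by
    have h3 : (3 * L) ^ (1 - 2 * ρ) ≤ 3 * L := by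
      have h := Real.rpow_le_rpow_of_exponent_le (show (1 : ℝ) ≤ 3 * L by linarith) (show 1 - 2 * ρ ≤ 1 by linarith)
      rwa [Real.rpow_one] at h
    rw [← ENNReal.ofReal_coe_nnreal, ← ENNReal.ofReal_mul (NNReal.coe_nonneg c)]
    exact ENNReal.ofReal_le_ofReal (mul_le_mul_of_nonneg_left h3 (NNReal.coe_nonneg c))
  have hreal : (γ * L / 2) ^ 2 * ((L / 2) ^ 3 * (π * 4 / 3)) ≤ (c : ℝ) * (3 * L) :=
    (ENNReal.ofReal_le_ofReal_iff (by positivity)).1 ((hmass.trans hA3).trans hup)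
  -- contradiction: `π γ² L⁵ / 24 ≤ 3 c L` against `γ² L⁴ ≥ γ² L ≥ 24 (c + 1)`
  have hπ : (3 : ℝ) < π := Real.pi_gt_three
  have hid : (γ * L / 2) ^ 2 * ((L / 2) ^ 3 * (π * 4 / 3)) = (π * (γ ^ 2 * L ^ 4)) * L / 24 := by ring
  rw [hid] at hreal
  have e1 : π * (γ ^ 2 * L ^ 4) ≤ 72 * (c : ℝ) := by
    by_contra h
    rw [not_le] at h
    have := mul_lt_mul_of_pos_right h hL
    linarith
  have e2 : 3 * (γ ^ 2 * L ^ 4) ≤ π * (γ ^ 2 * L ^ 4) :=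
    mul_le_mul_of_nonneg_right hπ.le (by positivity)
  have hL3 : 1 ≤ L ^ 3 := one_le_pow₀ hL1
  have e3 : γ ^ 2 * L ≤ γ ^ 2 * L ^ 4 := by
    have h := mul_le_mul_of_nonneg_left hL3 (by positivity : 0 ≤ γ ^ 2 * L)
    calc γ ^ 2 * L = γ ^ 2 * L * 1 := (mul_one _).symm
      _ ≤ γ ^ 2 * L * L ^ 3 := h
      _ = γ ^ 2 * L ^ 4 := by ring
  have e4 : 24 * ((c : ℝ) + 1) ≤ γ ^ 2 * L := by
    have h := hLc
    rw [div_le_iff₀ (by positivity)] at h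
    linarith
  linarith

/-- **The core on the sphere (mean-value step).**  `‖∇V‖ ≤ G` on `B_{3L}`, a `γ`-fast point `y` on `S_t`, `t ∈ (L,2L)`, with
`‖V y‖ ≤ G L`; then for `η ≤ L/2` with `7ηG ≤ γL`, every `y′` with `‖y′ − y‖ ≤ η` has `−⟪y′, V y′⟫ ≥ (γ/2) t²`.
[folklore] -/
theorem core_on_sphere (hVd : Differentiable ℝ V) {γ L t G η : ℝ} {y y' : EuclideanSpace ℝ (Fin 3)} (hγ : 0 ≤ γ)
    (hL : 0 < L) (hG : ∀ x ∈ ball (0 : EuclideanSpace ℝ (Fin 3)) (3 * L), ‖fderiv ℝ V x‖ ≤ G) (hG0 : 0 ≤ G)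
    (ht : t ∈ Ioo L (2 * L)) (hy : ‖y‖ = t) (hfast : ⟪y, V y⟫ ≤ -(γ * ‖y‖ ^ 2)) (hVy : ‖V y‖ ≤ G * L)
    (hη : η ≤ L / 2) (hηG : 7 * (η * G) ≤ γ * L) (hd : ‖y' - y‖ ≤ η) :
    γ / 2 * t ^ 2 ≤ -⟪y', V y'⟫ := by
  have hη0 : 0 ≤ η := (norm_nonneg _).trans hd
  have hy2 : ‖y‖ < 2 * L := by rw [hy]; exact ht.2
  have hmv : ‖V y' - V y‖ ≤ G * η := (norm_sub_le_of_grad hVd hG hy2 (hd.trans hη)).trans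
    (mul_le_mul_of_nonneg_left hd hG0)
  have hVy' : ‖V y'‖ ≤ G * L + G * η := by
    have h := norm_add_le (V y) (V y' - V y)
    rw [add_sub_cancel] at h
    linarith
  have hdec : ⟪y', V y'⟫ = ⟪y, V y⟫ + ⟪y' - y, V y'⟫ + ⟪y, V y' - V y⟫ := by
    rw [inner_sub_left, inner_sub_right]; ring
  have hb1 : ⟪y' - y, V y'⟫ ≤ η * (G * L + G * η) :=
    (real_inner_le_norm _ _).trans (mul_le_mul hd hVy' (norm_nonneg _) hη0)
  have hb2 : ⟪y, V y' - V y⟫ ≤ t * (G * η) := by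
    have h := real_inner_le_norm y (V y' - V y)
    rw [hy] at h
    exact h.trans (mul_le_mul_of_nonneg_left hmv (by linarith [ht.1]))
  have hf : γ * t ^ 2 ≤ -⟪y, V y⟫ := by rw [hy] at hfast; linarith
  -- loss `ηG(L + η + t) ≤ ηG · (7L/2) ≤ γL²/2 ≤ γt²/2`
  have hηG0 : 0 ≤ η * G := mul_nonneg hη0 hG0
  have hl1 : η * (G * L + G * η) + t * (G * η) = η * G * (L + η + t) := by ring
  have hl2 : η * G * (L + η + t) ≤ η * G * (7 * L / 2) :=
    mul_le_mul_of_nonneg_left (by linarith [ht.2]) hηG0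
  have hl3 : η * G * (7 * L / 2) ≤ γ * L ^ 2 / 2 := by nlinarith
  have hl4 : γ * L ^ 2 ≤ γ * t ^ 2 := mul_le_mul_of_nonneg_left (pow_le_pow_left₀ hL.le ht.1.le 2) hγ
  rw [hdec]
  linarith

end FastPoint

section Chart

variable {V : EuclideanSpace ℝ (Fin 3) → EuclideanSpace ℝ (Fin 3)} {e e₁ e₂ : EuclideanSpace ℝ (Fin 3)}

/-- The orthographic chart is `23/10`-Lipschitz on the chart disc `‖z‖ ≤ 0.9t` (`t/√(t² − 0.81t²) = 10/√19 ≤ 23/10`).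
[folklore] -/
theorem chart_lipschitz (hon : Orthonormal ℝ ![e, e₁, e₂]) {t : ℝ} (ht : 0 < t) {z z' : ℂ} (hz : ‖z‖ ≤ 9 / 10 * t)
    (hz' : ‖z'‖ ≤ 9 / 10 * t) : ‖sphereChart e e₁ e₂ t z - sphereChart e e₁ e₂ t z'‖ ≤ 23 / 10 * ‖z - z'‖ := by
  have hr : 9 / 10 * t < t := by linarith
  have h := norm_sphereChart_sub_le (norm_frame₀ hon) (norm_frame₁ hon) (norm_frame₂ hon) (inner_frame₀₁ hon)
    (inner_frame₀₂ hon) (inner_frame₁₂ hon) hr hz hz'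
  have hs : 10 * t / 23 ≤ Real.sqrt (t ^ 2 - (9 / 10 * t) ^ 2) := by
    calc 10 * t / 23 = Real.sqrt ((10 * t / 23) ^ 2) := (Real.sqrt_sq (by positivity)).symm
      _ ≤ Real.sqrt (t ^ 2 - (9 / 10 * t) ^ 2) := Real.sqrt_le_sqrt (by nlinarith)
  have hK : t / Real.sqrt (t ^ 2 - (9 / 10 * t) ^ 2) ≤ 23 / 10 := by
    calc t / Real.sqrt (t ^ 2 - (9 / 10 * t) ^ 2) ≤ t / (10 * t / 23) :=
          div_le_div_of_nonneg_left ht.le (by positivity) hs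
      _ = 23 / 10 := by field_simp
  exact h.trans (mul_le_mul_of_nonneg_right hK (norm_nonneg _))

/-- **The core read through the chart.**  In the situation of `core_on_sphere`, if `y = Φ_t(z₀)` with `‖z₀‖ ≤ 0.82t`,
`w ≤ t/25` and `(23/10)w ≤ η`, then `−⟪Φ_t(z₀+ζ), V(Φ_t(z₀+ζ))⟫ ≥ (γ/2)t²` for all `‖ζ‖ ≤ w`. [folklore] -/
theorem chart_core (hVd : Differentiable ℝ V) (hon : Orthonormal ℝ ![e, e₁, e₂]) {γ L t G η w : ℝ}
    {y : EuclideanSpace ℝ (Fin 3)} {z₀ : ℂ} (hγ : 0 ≤ γ) (hL : 0 < L)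
    (hG : ∀ x ∈ ball (0 : EuclideanSpace ℝ (Fin 3)) (3 * L), ‖fderiv ℝ V x‖ ≤ G) (hG0 : 0 ≤ G)
    (ht : t ∈ Ioo L (2 * L)) (hy : ‖y‖ = t) (hfast : ⟪y, V y⟫ ≤ -(γ * ‖y‖ ^ 2)) (hVy : ‖V y‖ ≤ G * L)
    (hη : η ≤ L / 2) (hηG : 7 * (η * G) ≤ γ * L) (hz₀ : ‖z₀‖ ≤ 41 / 50 * t) (hΦ : sphereChart e e₁ e₂ t z₀ = y)
    (hw : w ≤ t / 25) (hwη : 23 / 10 * w ≤ η) :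
    ∀ ζ : ℂ, ‖ζ‖ ≤ w →
      γ / 2 * t ^ 2 ≤ -⟪sphereChart e e₁ e₂ t (z₀ + ζ), V (sphereChart e e₁ e₂ t (z₀ + ζ))⟫ := by
  intro ζ hζ
  have htpos : 0 < t := hL.trans ht.1
  have hz₀r : ‖z₀‖ ≤ 9 / 10 * t := by linarith
  have hzr : ‖z₀ + ζ‖ ≤ 9 / 10 * t := (norm_add_le _ _).trans (by linarith)
  have hd : ‖sphereChart e e₁ e₂ t (z₀ + ζ) - y‖ ≤ η := by
    rw [← hΦ]
    calc ‖sphereChart e e₁ e₂ t (z₀ + ζ) - sphereChart e e₁ e₂ t z₀‖ ≤ 23 / 10 * ‖z₀ + ζ - z₀‖ :=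
          chart_lipschitz hon htpos hzr hz₀r
      _ = 23 / 10 * ‖ζ‖ := by rw [add_sub_cancel_left]
      _ ≤ η := by linarith [mul_le_mul_of_nonneg_left hζ (by norm_num : (0 : ℝ) ≤ 23 / 10)]
  exact core_on_sphere hVd hγ hL hG hG0 ht hy hfast hVy hη hηG hd

end Chart

/-! ## Real-variable bookkeeping -/

/-- The area budget of `exists_thin_sphere` with `κ = γ/2`, `𝓐 = (c+1)(2L)^{1−2ρ}`, `δ = 2t/25`, `w ≤ t/25`:
`64𝓐/(κ²L³) ≤ π(δ² − w²)/2` once `L ≥ 1` and `L ≥ 72000(c+1)/γ²`. [folklore] -/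
theorem aux_budget {c γ L t w ρ : ℝ} (hc : 0 ≤ c) (hγ : 0 < γ) (hρ : 0 ≤ ρ) (hL1 : 1 ≤ L)
    (hLA : 72000 * (c + 1) / γ ^ 2 ≤ L) (ht : t ∈ Ioo L (2 * L)) (hw0 : 0 ≤ w) (hw : w ≤ t / 25) :
    64 * ((c + 1) * (2 * L) ^ (1 - 2 * ρ)) / ((γ / 2) ^ 2 * L ^ 3) ≤ π * ((2 / 25 * t) ^ 2 - w ^ 2) / 2 := by
  have hL : 0 < L := by linarith
  have h2L : (2 * L) ^ (1 - 2 * ρ) ≤ 2 * L := by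
    have h := Real.rpow_le_rpow_of_exponent_le (show (1 : ℝ) ≤ 2 * L by linarith) (show 1 - 2 * ρ ≤ 1 by linarith)
    rwa [Real.rpow_one] at h
  have hlhs : 64 * ((c + 1) * (2 * L) ^ (1 - 2 * ρ)) / ((γ / 2) ^ 2 * L ^ 3) ≤ 512 * (c + 1) / (γ ^ 2 * L ^ 2) := by
    rw [div_le_div_iff₀ (by positivity) (by positivity)]
    have h := mul_le_mul_of_nonneg_left h2L (by positivity : 0 ≤ 64 * (c + 1) * (γ ^ 2 * L ^ 2))
    calc 64 * ((c + 1) * (2 * L) ^ (1 - 2 * ρ)) * (γ ^ 2 * L ^ 2)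
        = 64 * (c + 1) * (γ ^ 2 * L ^ 2) * (2 * L) ^ (1 - 2 * ρ) := by ring
      _ ≤ 64 * (c + 1) * (γ ^ 2 * L ^ 2) * (2 * L) := h
      _ = 512 * (c + 1) * ((γ / 2) ^ 2 * L ^ 3) := by ring
  have hmid : 512 * (c + 1) / (γ ^ 2 * L ^ 2) ≤ 9 * L ^ 2 / 1250 := by
    rw [div_le_div_iff₀ (by positivity) (by positivity)]
    have h1 : 72000 * (c + 1) ≤ γ ^ 2 * L := by
      have h := hLA
      rw [div_le_iff₀ (by positivity)] at h
      linarith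
    have hL3 : 1 ≤ L ^ 3 := one_le_pow₀ hL1
    have h2 : γ ^ 2 * L ≤ γ ^ 2 * L ^ 4 := by
      have h := mul_le_mul_of_nonneg_left hL3 (by positivity : 0 ≤ γ ^ 2 * L)
      calc γ ^ 2 * L = γ ^ 2 * L * 1 := (mul_one _).symm
        _ ≤ γ ^ 2 * L * L ^ 3 := h
        _ = γ ^ 2 * L ^ 4 := by ring
    calc 512 * (c + 1) * 1250 = 640000 * (c + 1) := by ring
      _ ≤ 9 * (γ ^ 2 * L ^ 4) := by linarith
      _ = 9 * L ^ 2 * (γ ^ 2 * L ^ 2) := by ring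
  have hrhs : 9 * L ^ 2 / 1250 ≤ π * ((2 / 25 * t) ^ 2 - w ^ 2) / 2 := by
    have hπ := Real.pi_gt_three
    have htL : L ^ 2 ≤ t ^ 2 := pow_le_pow_left₀ hL.le ht.1.le 2
    have hw2 : w ^ 2 ≤ (t / 25) ^ 2 := pow_le_pow_left₀ hw0 hw 2
    have h1 : 3 * t ^ 2 / 625 ≤ (2 / 25 * t) ^ 2 - w ^ 2 := by
      have : (2 / 25 * t) ^ 2 = 4 * t ^ 2 / 625 := by ring
      have : (t / 25) ^ 2 = t ^ 2 / 625 := by ring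
      linarith
    have h2 : π * (3 * t ^ 2 / 625) ≤ π * ((2 / 25 * t) ^ 2 - w ^ 2) := mul_le_mul_of_nonneg_left h1 Real.pi_pos.le
    have h3 : 3 * (3 * t ^ 2 / 625) ≤ π * (3 * t ^ 2 / 625) := mul_le_mul_of_nonneg_right hπ.le (by positivity)
    linarith
  exact hlhs.trans (hmid.trans hrhs)

/-- The exponent of `exists_thin_sphere` dominates `β L^{2+ρ}`, `β = 19πγ²/(51200(2(c+1)+8C))`:
with `𝓐 = (c+1)(2L)^{1−2ρ}`, `𝓔 = (2L)^{1−ρ}C`, `κ = γ/2`, `t > L ≥ 1`, `0 ≤ ρ`,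
`β L^{2+ρ} ≤ 19πκ²t⁴L/(12800(𝓐 + 4L²𝓔))` (since `𝓐 + 4L²𝓔 ≤ (2(c+1)+8C)L^{3−ρ}`). [folklore] -/
theorem aux_exponent {c C γ L t ρ : ℝ} (hc : 0 ≤ c) (hC : 0 < C) (hγ : 0 < γ) (hρ0 : 0 ≤ ρ) (hL1 : 1 ≤ L)
    (ht : L < t) :
    19 * π * γ ^ 2 / (51200 * (2 * (c + 1) + 8 * C)) * L ^ (2 + ρ) ≤
      19 * π * (γ / 2) ^ 2 * t ^ 4 * L /
        (12800 * ((c + 1) * (2 * L) ^ (1 - 2 * ρ) + 4 * L ^ 2 * ((2 * L) ^ (1 - ρ) * C))) := by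
  have hL : 0 < L := by linarith
  have hγ2 : 0 < γ ^ 2 := by positivity
  have hP : 0 < L ^ (3 - ρ) := Real.rpow_pos_of_pos hL _
  have hQ : 0 < L ^ (2 + ρ) := Real.rpow_pos_of_pos hL _
  have hA0 : 0 < (2 * L) ^ (1 - 2 * ρ) := Real.rpow_pos_of_pos (by linarith) _
  have hE0 : 0 < (2 * L) ^ (1 - ρ) := Real.rpow_pos_of_pos (by linarith) _
  have h2a : (2 : ℝ) ^ (1 - 2 * ρ) ≤ 2 := by
    have h := Real.rpow_le_rpow_of_exponent_le (show (1 : ℝ) ≤ 2 by norm_num) (show 1 - 2 * ρ ≤ 1 by linarith)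
    rwa [Real.rpow_one] at h
  have h2b : (2 : ℝ) ^ (1 - ρ) ≤ 2 := by
    have h := Real.rpow_le_rpow_of_exponent_le (show (1 : ℝ) ≤ 2 by norm_num) (show 1 - ρ ≤ 1 by linarith)
    rwa [Real.rpow_one] at h
  have h1 : (2 * L) ^ (1 - 2 * ρ) ≤ 2 * L ^ (3 - ρ) := by
    rw [Real.mul_rpow (by norm_num) hL.le]
    have hb : L ^ (1 - 2 * ρ) ≤ L ^ (3 - ρ) := Real.rpow_le_rpow_of_exponent_le hL1 (by linarith)
    exact mul_le_mul h2a hb (Real.rpow_nonneg hL.le _) (by norm_num)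
  have hb3 : L ^ 2 * L ^ (1 - ρ) = L ^ (3 - ρ) := by
    rw [← Real.rpow_natCast L 2, ← Real.rpow_add hL]
    congr 1
    push_cast
    ring
  have h2 : 4 * L ^ 2 * ((2 * L) ^ (1 - ρ) * C) ≤ 8 * C * L ^ (3 - ρ) := by
    rw [Real.mul_rpow (by norm_num) hL.le]
    have hLr : 0 ≤ L ^ (1 - ρ) := Real.rpow_nonneg hL.le _
    have h := mul_le_mul_of_nonneg_right h2b (by positivity : 0 ≤ 4 * C * (L ^ 2 * L ^ (1 - ρ)))
    calc 4 * L ^ 2 * (2 ^ (1 - ρ) * L ^ (1 - ρ) * C) = 2 ^ (1 - ρ) * (4 * C * (L ^ 2 * L ^ (1 - ρ))) := by ring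
      _ ≤ 2 * (4 * C * (L ^ 2 * L ^ (1 - ρ))) := h
      _ = 8 * C * L ^ (3 - ρ) := by rw [hb3]; ring
  have hX : (c + 1) * (2 * L) ^ (1 - 2 * ρ) + 4 * L ^ 2 * ((2 * L) ^ (1 - ρ) * C) ≤
      (2 * (c + 1) + 8 * C) * L ^ (3 - ρ) := by
    have h := mul_le_mul_of_nonneg_left h1 (by positivity : 0 ≤ c + 1)
    calc (c + 1) * (2 * L) ^ (1 - 2 * ρ) + 4 * L ^ 2 * ((2 * L) ^ (1 - ρ) * C)
        ≤ (c + 1) * (2 * L ^ (3 - ρ)) + 8 * C * L ^ (3 - ρ) := add_le_add h h2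
      _ = (2 * (c + 1) + 8 * C) * L ^ (3 - ρ) := by ring
  have ht4 : L ^ 4 ≤ t ^ 4 := pow_le_pow_left₀ hL.le ht.le 4
  have hsplit : L ^ 4 * L = L ^ (2 + ρ) * L ^ (3 - ρ) := by
    rw [← Real.rpow_add hL, show (2 + ρ) + (3 - ρ) = ((5 : ℕ) : ℝ) by push_cast; ring, Real.rpow_natCast]
    ring
  have key : L ^ (2 + ρ) * ((c + 1) * (2 * L) ^ (1 - 2 * ρ) + 4 * L ^ 2 * ((2 * L) ^ (1 - ρ) * C)) ≤
      (2 * (c + 1) + 8 * C) * (t ^ 4 * L) := by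
    calc L ^ (2 + ρ) * ((c + 1) * (2 * L) ^ (1 - 2 * ρ) + 4 * L ^ 2 * ((2 * L) ^ (1 - ρ) * C))
        ≤ L ^ (2 + ρ) * ((2 * (c + 1) + 8 * C) * L ^ (3 - ρ)) := mul_le_mul_of_nonneg_left hX hQ.le
      _ = (2 * (c + 1) + 8 * C) * (L ^ 4 * L) := by rw [hsplit]; ring
      _ ≤ (2 * (c + 1) + 8 * C) * (t ^ 4 * L) := by gcongr
  rw [div_mul_eq_mul_div, div_le_div_iff₀ (by positivity) (by positivity)]
  calc 19 * π * γ ^ 2 * L ^ (2 + ρ) *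
        (12800 * ((c + 1) * (2 * L) ^ (1 - 2 * ρ) + 4 * L ^ 2 * ((2 * L) ^ (1 - ρ) * C)))
      = (243200 * π * γ ^ 2) *
          (L ^ (2 + ρ) * ((c + 1) * (2 * L) ^ (1 - 2 * ρ) + 4 * L ^ 2 * ((2 * L) ^ (1 - ρ) * C))) := by ring
    _ ≤ (243200 * π * γ ^ 2) * ((2 * (c + 1) + 8 * C) * (t ^ 4 * L)) :=
        mul_le_mul_of_nonneg_left key (by positivity)
    _ = 19 * π * (γ / 2) ^ 2 * t ^ 4 * L * (51200 * (2 * (c + 1) + 8 * C)) := by ring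

/-- **The contradiction step.**  If `w = min((10/23)η, t/25)`, `η = min(L/2, γL/(7G))`, `e^{−E} < 1/2` and
`w ≤ (2t/25)e^{−E}`, then `w`, `η` take their second values and `(γ/3)e^{E} ≤ G`. [folklore] -/
theorem aux_contra {γ L t G η w E : ℝ} (hγ : 0 < γ) (hL : 0 < L) (hG : 0 < G) (ht : t ∈ Ioo L (2 * L))
    (hη : η = min (L / 2) (γ * L / (7 * G))) (hwdef : w = min (10 / 23 * η) (t / 25))
    (hE2 : Real.exp (-E) < 1 / 2) (hw : w ≤ 2 / 25 * t * Real.exp (-E)) : γ / 3 * Real.exp E ≤ G := by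
  have he0 : 0 < Real.exp (-E) := Real.exp_pos _
  have htpos : 0 < t := hL.trans ht.1
  have hte := mul_lt_mul_of_pos_left hE2 (by positivity : (0 : ℝ) < 2 / 25 * t)
  have hw1 : w = 10 / 23 * η := by
    rw [hwdef]
    refine min_eq_left ?_
    by_contra h
    rw [not_le] at h
    have hw' : w = t / 25 := by rw [hwdef]; exact min_eq_right h.le
    rw [hw'] at hw
    linarith
  have hη1 : η = γ * L / (7 * G) := by
    rw [hη]
    refine min_eq_right ?_
    by_contra h
    rw [not_le] at h
    have hη' : η = L / 2 := by rw [hη]; exact min_eq_left h.le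
    rw [hw1, hη'] at hw
    linarith [ht.2]
  rw [hw1, hη1] at hw
  have h1 : 10 * γ * L / (161 * G) ≤ 4 / 25 * L * Real.exp (-E) := by
    calc 10 * γ * L / (161 * G) = 10 / 23 * (γ * L / (7 * G)) := by field_simp; ring
      _ ≤ 2 / 25 * t * Real.exp (-E) := hw
      _ ≤ 4 / 25 * L * Real.exp (-E) := by nlinarith [ht.2, he0]
  rw [div_le_iff₀ (by positivity)] at h1
  have h3 : γ ≤ 3 * G * Real.exp (-E) := by
    by_contra hc
    rw [not_le] at hc
    have := mul_lt_mul_of_pos_right hc (by positivity : (0 : ℝ) < 10 * L)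
    nlinarith [he0, hG, hL]
  have hmul : Real.exp (-E) * Real.exp E = 1 := by rw [← Real.exp_add, neg_add_cancel, Real.exp_zero]
  calc γ / 3 * Real.exp E ≤ 3 * G * Real.exp (-E) / 3 * Real.exp E := by gcongr
    _ = G * (Real.exp (-E) * Real.exp E) := by ring
    _ = G := by rw [hmul, mul_one]

end Summit.NavierStokesRegularity.NavierStokesRegularity.Theorems.PowerGaugeEulerLiouville.NeedleSphereGrowth
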